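import Summits.CriticalPhenomena.PercolationContinuityZ3.Theorems.FK.InfiniteVolumeDefs
import Literature.Probability.LatticeModels.RandomClusterFiniteVolumePressure
import Literature.Analysis.Convex.PointwiseLimitDerivAt
import Mathlib.Analysis.SpecialFunctions.Log.Basic
import HarnessLib

/-!
# FK-continuity cell, FO-10a (pressure layer): the random-cluster pressure is CONVEX — in `π = log(p/(1−p))`, and JOINTLY in
# `(π, κ) = (log(p/(1−p)), log q)` — Grimmett 2006, Thm. (4.58), convexity clause, from the supporting lines / planes of the finite-volume pressure

Registered R86 (cell INBOX l.6153, 2026-08-24; supersedes the R85 bytes of l.6116); registry row FO-10a-g338c; label PCV-A (coordinator fk-4 g187).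
Cell `fk-continuity` (bschramm), row FO-10a (domain-Markov + comparison layer over FO-06); support file for the
FK-continuity transplant (`--supports stmt-CriticalPhenomena-4575`); builds on p205010 (kernel theorem, internal audit
signed; external expert review pending). Pure proofs; no definitions, no named facts, no sorries; general `d`.
UNCONDITIONAL finite- and infinite-volume structure; it decides nothing about FH / TP_FK / the value of `p_c(q)`.

With the logistic chart `p = σ(π) = e^π/(1+e^π)` (so `π = log(p/(1−p))`, Grimmett's (4.56)) and `Y^B_G(π) = Z^B_G(p,q)/(1−p)^{|E(G)|}`
(Grimmett's (4.54)–(4.55)), the finite-volume function `π ↦ log Y^B_G(π)` has at every `π₁` the supporting line of slope `E^B_{G,p₁,q}|ω|`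
(Literature `log_rcPartitionFunction_sub_ge`, Jensen), hence is convex ("It is clear from its form that `G^ξ_Λ(π,κ)` is a convex function",
proof of Thm. (4.58)); convexity passes to pointwise limits, so every limit of the per-site box pressures read in the `π`-chart is convex:

* `convexOn_univ_of_forall_exists_support` — a real function with a supporting line at every point is convex (folklore); the passage to
  pointwise limits is Literature `Literature.Analysis.Convex.convexOn_univ_of_tendsto` (`PointwiseLimitDerivAt.lean`, reused by name);
* `logistic_mem_Ioo`, `log_logistic_sub_log_one_sub_logistic` — `σ(π) ∈ (0,1)`, `log σ(π) − log(1 − σ(π)) = π`;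
* **`convexOn_log_rcPartitionFunction_logistic`** — for every finite graph `G`, wired set `B` and `q > 0`:
  `π ↦ log Z^B_G(σ(π),q) − |E(G)| log(1 − σ(π))` (= `log Y^B_G(π)`) is convex on `ℝ` (Grimmett 2006, proof of Thm. (4.58), convexity of `G^ξ_Λ`);
* **`convexOn_pressure_logistic`** — if `|Λ_N|⁻¹ log Z^b_{Λ_N}(x,q) → Φ(x)` for `x ∈ (0,1)` and `|E_{Λ_N}|/|Λ_N| → d`, then
  `π ↦ Φ(σ(π)) − d log(1 − σ(π))` (= `d · G(π,κ)` per site, (4.70)) is convex on `ℝ` (Thm. (4.58): "G is a convex function", here in `π` for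
  fixed `κ = log q`; the hypotheses are discharged by `PressureThermodynamicLimit` / `LatticeEdgeCounting`).

* **joint version** ((4.58) as printed: "G is a convex function on its domain ℝ²"): `rcWeight_eq_mul_ratio₂`, **`log_rcPartitionFunction_sub_ge₂`**
  (the TWO-parameter tangent inequality `log Z(p₂,q₂) − log Z(p₁,q₁) ≥ log(p₂/p₁) E₁|ω| + log((1−p₂)/(1−p₁))(|E| − E₁|ω|) + log(q₂/q₁) E₁ k^B`,
  Jensen; gradient (4.72) `(φ(|η|), φ(k))`), `convexOn_of_forall_exists_support₂`, `convexOn_prod_of_tendsto` (pointwise limits on a convex subset of `ℝ × ℝ`),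
  **`convexOn_log_rcPartitionFunction_logistic_exp`** (`(π,κ) ↦ log Y^B_G(π,κ) = log Z^B_G(σ(π), e^κ) − |E| log(1 − σ(π))` convex on `ℝ × ℝ` for every
  finite graph and wired set), **`convexOn_pressure_logistic_exp`** (every per-site limit `Ψ(σ(π), e^κ) − d log(1 − σ(π))` is convex on `ℝ × K`,
  `K` convex, given the limits on `ℝ × K` and `|E_{Λ_N}|/|Λ_N| → d`; `K = [0,∞)` ↔ `q ≥ 1`).

Honest framing: convexity statements (in `π`, and jointly in `(π,κ)` on the region where the limits are assumed); no statement about `p_c(q)`;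
NOT a binder discharge, NOT `_r4`.

## References

* G. Grimmett, *The Random-Cluster Model*, Springer 2006 (`book:grimmett2006-random-cluster-model`): §4.5, (4.54)–(4.56), Thm. (4.58) and
  its proof (convexity of `G^ξ_Λ`, (4.70)–(4.72)) [PDF pp. 88–92]. [Grimmett2006]
-/

noncomputable section

open Finset Filter Topology Set

namespace Summit.CriticalPhenomena.PercolationContinuityZ3.Theorems.FK

open Literature.Probability.Percolation Literature.Probability.LatticeModels

/-! ### A folklore convexity fact -/

section Convex

/-- **A real function with a supporting line at every point is convex.** [folklore] -/
theorem convexOn_univ_of_forall_exists_support {f : ℝ → ℝ} (h : ∀ z : ℝ, ∃ m : ℝ, ∀ x : ℝ, f z + m * (x - z) ≤ f x) :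
    ConvexOn ℝ Set.univ f := by
  refine ⟨convex_univ, fun x _ y _ a b ha hb hab => ?_⟩
  obtain ⟨m, hm⟩ := h (a • x + b • y)
  have hx := hm x
  have hy := hm y
  simp only [smul_eq_mul] at hx hy ⊢
  have key : a * f (a * x + b * y) + b * f (a * x + b * y) ≤ a * f x + b * f y := by
    have h1 := mul_le_mul_of_nonneg_left hx ha
    have h2 := mul_le_mul_of_nonneg_left hy hb
    have e : a * (f (a * x + b * y) + m * (x - (a * x + b * y))) + b * (f (a * x + b * y) + m * (y - (a * x + b * y))) =
        a * f (a * x + b * y) + b * f (a * x + b * y) + m * ((a + b) * (a * x + b * y) - (a * x + b * y)) * 0 +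
          m * (a * x + b * y - (a + b) * (a * x + b * y)) := by ring
    have e' : m * (a * x + b * y - (a + b) * (a * x + b * y)) = 0 := by rw [hab]; ring
    linarith
  calc f (a * x + b * y) = (a + b) * f (a * x + b * y) := by rw [hab, one_mul]
    _ = a * f (a * x + b * y) + b * f (a * x + b * y) := by ring
    _ ≤ a * f x + b * f y := key

end Convex

/-! ### The logistic chart `p = σ(π) = e^π / (1 + e^π)` -/

section Logistic

/-- `σ(π) = e^π/(1+e^π) ∈ (0,1)`. [cite: Grimmett2006, (4.56)] -/
theorem logistic_mem_Ioo (π : ℝ) : Real.exp π / (1 + Real.exp π) ∈ Set.Ioo (0 : ℝ) 1 := by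
  have h := Real.exp_pos π
  constructor
  · positivity
  · rw [div_lt_one (by positivity)]
    linarith

/-- `1 − σ(π) = 1/(1+e^π)`. [cite: Grimmett2006, (4.56)] -/
theorem one_sub_logistic (π : ℝ) : 1 - Real.exp π / (1 + Real.exp π) = 1 / (1 + Real.exp π) := by
  have h : (1 + Real.exp π) ≠ 0 := by positivity
  field_simp
  ring

/-- `log σ(π) − log(1 − σ(π)) = π` (i.e. `π = log(p/(1−p))`). [cite: Grimmett2006, (4.56)] -/
theorem log_logistic_sub_log_one_sub_logistic (π : ℝ) :
    Real.log (Real.exp π / (1 + Real.exp π)) - Real.log (1 - Real.exp π / (1 + Real.exp π)) = π := by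
  have h1 : (0 : ℝ) < 1 + Real.exp π := by positivity
  rw [one_sub_logistic, Real.log_div (Real.exp_pos π).ne' h1.ne', Real.log_div one_ne_zero h1.ne', Real.log_one,
    Real.log_exp]
  ring

end Logistic

/-! ### Convexity of the finite-volume pressure in `π` -/

section FiniteVolume

variable {V : Type*} [Fintype V] [DecidableEq V] (G : SimpleGraph V) [DecidableRel G.Adj]

/-- **The finite-volume pressure is convex in `π`** (Grimmett 2006, proof of Thm. (4.58): "It is clear from its form that `G^ξ_Λ(π,κ)` is a
convex function"; here from the supporting lines of Literature `log_rcPartitionFunction_sub_ge`, slope `E^B_{G,p,q}|ω|` at `π = log(p/(1−p))`):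
for `q > 0` and every wired set `B`, `π ↦ log Z^B_G(σ(π), q) − |E(G)| log(1 − σ(π))` (`= log Y^B_G(π, log q)`, (4.54)–(4.55)) is convex on `ℝ`.
[cite: Grimmett2006, proof of Thm. (4.58) (convexity of G^ξ_Λ) with (4.54)–(4.56)] -/
theorem convexOn_log_rcPartitionFunction_logistic {q : ℝ} (hq : 0 < q) (B : Set V) :
    ConvexOn ℝ Set.univ (fun π : ℝ =>
      Real.log (rcPartitionFunction G (Real.exp π / (1 + Real.exp π)) q B) -
        (#G.edgeFinset : ℝ) * Real.log (1 - Real.exp π / (1 + Real.exp π))) := by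
  refine convexOn_univ_of_forall_exists_support fun z => ?_
  refine ⟨rcExpect G (Real.exp z / (1 + Real.exp z)) q B (fun ω => (#ω : ℝ)), fun x => ?_⟩
  have hz := logistic_mem_Ioo z
  have hx := logistic_mem_Ioo x
  have key := log_rcPartitionFunction_sub_ge G hz hx hq B
  -- `log(p₂/p₁) = log p₂ − log p₁`, `log((1−p₂)/(1−p₁)) = log(1−p₂) − log(1−p₁)`, and `log σ − log(1−σ) = π`
  rw [Real.log_div hx.1.ne' hz.1.ne', Real.log_div (sub_pos.2 hx.2).ne' (sub_pos.2 hz.2).ne'] at key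
  have ex := log_logistic_sub_log_one_sub_logistic x
  have ez := log_logistic_sub_log_one_sub_logistic z
  set E := rcExpect G (Real.exp z / (1 + Real.exp z)) q B (fun ω => (#ω : ℝ)) with hE
  -- the supporting line: `log Y(x) − log Y(z) ≥ E · (x − z)`
  have h : E * (x - z) = (Real.log (Real.exp x / (1 + Real.exp x)) - Real.log (Real.exp z / (1 + Real.exp z))) * E +
      (Real.log (1 - Real.exp x / (1 + Real.exp x)) - Real.log (1 - Real.exp z / (1 + Real.exp z))) * ((#G.edgeFinset : ℝ) - E) -
        (#G.edgeFinset : ℝ) * (Real.log (1 - Real.exp x / (1 + Real.exp x)) - Real.log (1 - Real.exp z / (1 + Real.exp z))) := by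
    have : x - z = (Real.log (Real.exp x / (1 + Real.exp x)) - Real.log (1 - Real.exp x / (1 + Real.exp x))) -
        (Real.log (Real.exp z / (1 + Real.exp z)) - Real.log (1 - Real.exp z / (1 + Real.exp z))) := by rw [ex, ez]
    rw [this]
    ring
  linarith

end FiniteVolume

/-! ### Convexity of the pressure in `π` -/

section Pressure

variable {d : ℕ} {q : ℝ} {Φ : ℝ → ℝ}

/-- **Grimmett 2006, Thm. (4.58), convexity clause (in `π`, per site)**: if `Φ` is the per-site pressure on `(0,1)` for some boundary
condition `b` (`|Λ_N|⁻¹ log Z^b_{Λ_N}(x,q) → Φ(x)`) and `|E_{Λ_N}|/|Λ_N| → d`, then `π ↦ Φ(σ(π)) − d log(1 − σ(π))` — Grimmett's `d · G(π, log q)`,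
(4.70) — is convex on `ℝ` (a pointwise limit of the convex finite-volume functions of `convexOn_log_rcPartitionFunction_logistic` divided by
`|Λ_N|`). [cite: Grimmett2006, Thm. (4.58) ("The 'pressure' function G is a convex function")] -/
theorem convexOn_pressure_logistic (hq : 0 < q) {b : Bool}
    (hΦ : ∀ x ∈ Set.Ioo (0 : ℝ) 1, Tendsto (fun N : ℕ =>
      Real.log (rcPartitionFunction (finsetGraph (zdGraph d) (box d N)) x q (boxBC d b N)) / #(box d N)) atTop (𝓝 (Φ x)))
    (hE : Tendsto (fun N : ℕ => (#(finsetGraph (zdGraph d) (box d N)).edgeFinset : ℝ) / #(box d N)) atTop (𝓝 (d : ℝ))) :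
    ConvexOn ℝ Set.univ (fun π : ℝ => Φ (Real.exp π / (1 + Real.exp π)) - d * Real.log (1 - Real.exp π / (1 + Real.exp π))) := by
  refine Literature.Analysis.Convex.convexOn_univ_of_tendsto (f := fun N π =>
      (Real.log (rcPartitionFunction (finsetGraph (zdGraph d) (box d N)) (Real.exp π / (1 + Real.exp π)) q (boxBC d b N)) -
        (#(finsetGraph (zdGraph d) (box d N)).edgeFinset : ℝ) * Real.log (1 - Real.exp π / (1 + Real.exp π))) / #(box d N))
    (fun N => ?_) (fun π => ?_)
  · -- convexity survives division by the positive constant `|Λ_N|`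
    have hpos : (0 : ℝ) < #(box d N) := by exact_mod_cast Finset.card_pos.2 (box_nonempty d N)
    have h := (convexOn_log_rcPartitionFunction_logistic (finsetGraph (zdGraph d) (box d N)) hq (boxBC d b N)).smul
      (inv_nonneg.2 hpos.le)
    refine h.congr fun π _ => ?_
    simp only [smul_eq_mul]
    ring
  · have h := ((hΦ _ (logistic_mem_Ioo π)).sub (hE.mul_const (Real.log (1 - Real.exp π / (1 + Real.exp π)))))
    refine h.congr fun N => ?_
    rw [sub_div, mul_div_right_comm]

end Pressure

/-! ### Joint convexity in `(π, κ)`: the two-parameter tangent inequality and supporting planes -/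

section Jensen

variable {V : Type*} [Fintype V] [DecidableEq V] (G : SimpleGraph V) [DecidableRel G.Adj]

/-- Changing `(p, q)`: `w_{p₂,q₂}(ω) = w_{p₁,q₁}(ω) · (p₂/p₁)^{|ω|} ((1-p₂)/(1-p₁))^{|E∖ω|} (q₂/q₁)^{k^B(ω)}` for `p₁ ∈ (0,1)`, `q₁ > 0`.
[cite: Grimmett2006, §1.2, eq. (1.2)] -/
theorem rcWeight_eq_mul_ratio₂ {p₁ q₁ : ℝ} (hp₁ : p₁ ∈ Set.Ioo (0 : ℝ) 1) (hq₁ : 0 < q₁) (p₂ q₂ : ℝ) (B : Set V)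
    (ω : Finset (Sym2 V)) :
    rcWeight G p₂ q₂ B ω = rcWeight G p₁ q₁ B ω *
      ((p₂ / p₁) ^ #ω * ((1 - p₂) / (1 - p₁)) ^ #(G.edgeFinset \ ω) *
        (q₂ / q₁) ^ clusterCount (↑ω : BondConfig V) B) := by
  have h1 : p₁ ≠ 0 := hp₁.1.ne'
  have h2 : 1 - p₁ ≠ 0 := (sub_pos.2 hp₁.2).ne'
  have h3 : q₁ ≠ 0 := hq₁.ne'
  unfold rcWeight
  rw [div_pow, div_pow, div_pow]
  field_simp

/-- **Two-parameter tangent inequality of the finite-volume pressure** (Jensen for `log`; the supporting plane of the jointly convex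
`(π,κ) ↦ log Y^B_G(π,κ)`, Grimmett 2006 proof of Thm. (4.58) with (4.72) `∇G^ξ_Λ = |E_Λ|⁻¹(φ(|η|), φ(k))`): for `p₁, p₂ ∈ (0,1)`, `q₁, q₂ > 0`,
`log(p₂/p₁) E₁|ω| + log((1−p₂)/(1−p₁)) (|E| − E₁|ω|) + log(q₂/q₁) E₁ k^B ≤ log Z^B_G(p₂,q₂) − log Z^B_G(p₁,q₁)`.
[cite: Grimmett2006, proof of Thm. (4.58) (convexity of G^ξ_Λ) and (4.72)] -/
theorem log_rcPartitionFunction_sub_ge₂ {p₁ p₂ q₁ q₂ : ℝ} (hp₁ : p₁ ∈ Set.Ioo (0 : ℝ) 1) (hp₂ : p₂ ∈ Set.Ioo (0 : ℝ) 1)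
    (hq₁ : 0 < q₁) (hq₂ : 0 < q₂) (B : Set V) :
    Real.log (p₂ / p₁) * rcExpect G p₁ q₁ B (fun ω => (#ω : ℝ)) +
        Real.log ((1 - p₂) / (1 - p₁)) * ((#G.edgeFinset : ℝ) - rcExpect G p₁ q₁ B (fun ω => (#ω : ℝ))) +
        Real.log (q₂ / q₁) * rcExpect G p₁ q₁ B (fun ω => (clusterCount (↑ω : BondConfig V) B : ℝ)) ≤
      Real.log (rcPartitionFunction G p₂ q₂ B) - Real.log (rcPartitionFunction G p₁ q₁ B) := by
  have hp₁' : p₁ ∈ Set.Icc (0 : ℝ) 1 := ⟨hp₁.1.le, hp₁.2.le⟩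
  have hZ₁ := rcPartitionFunction_pos G hp₁' hq₁ B
  have hZ₂ := rcPartitionFunction_pos G ⟨hp₂.1.le, hp₂.2.le⟩ hq₂ B
  have ha : 0 < p₂ / p₁ := div_pos hp₂.1 hp₁.1
  have hb : 0 < (1 - p₂) / (1 - p₁) := div_pos (sub_pos.2 hp₂.2) (sub_pos.2 hp₁.2)
  have hc : 0 < q₂ / q₁ := div_pos hq₂ hq₁
  set R : Finset (Sym2 V) → ℝ := fun ω =>
    (p₂ / p₁) ^ #ω * ((1 - p₂) / (1 - p₁)) ^ #(G.edgeFinset \ ω) *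
      (q₂ / q₁) ^ clusterCount (↑ω : BondConfig V) B with hR
  have hRpos : ∀ ω, 0 < R ω := fun ω => mul_pos (mul_pos (pow_pos ha _) (pow_pos hb _)) (pow_pos hc _)
  -- `Z(p₂,q₂)/Z(p₁,q₁) = E_{p₁,q₁} R`
  have hquot : rcPartitionFunction G p₂ q₂ B / rcPartitionFunction G p₁ q₁ B = rcExpect G p₁ q₁ B R := by
    rw [rcExpect, rcPartitionFunction, Finset.sum_div]
    refine Finset.sum_congr rfl fun ω _ => ?_
    rw [rcWeight_eq_mul_ratio₂ G hp₁ hq₁ p₂ q₂ B ω, mul_div_right_comm]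
  -- Jensen for the concave function `log`
  have hJ : rcExpect G p₁ q₁ B (fun ω => Real.log (R ω)) ≤ Real.log (rcExpect G p₁ q₁ B R) := by
    have := (strictConcaveOn_log_Ioi.concaveOn).le_map_sum
      (t := G.edgeFinset.powerset)
      (w := fun ω => rcWeight G p₁ q₁ B ω / rcPartitionFunction G p₁ q₁ B) (p := R)
      (fun ω _ => div_nonneg (rcWeight_nonneg G hp₁' hq₁.le B ω) hZ₁.le)
      (by
        have h := rcExpect_one G hp₁' hq₁ B
        simpa [rcExpect] using h)
      (fun ω _ => hRpos ω)
    simpa [rcExpect, smul_eq_mul] using this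
  -- the left side is `E log R`
  have hlogR : ∀ ω ⊆ G.edgeFinset, Real.log (R ω) =
      Real.log (p₂ / p₁) * (#ω : ℝ) + Real.log ((1 - p₂) / (1 - p₁)) * ((#G.edgeFinset : ℝ) - (#ω : ℝ)) +
        Real.log (q₂ / q₁) * (clusterCount (↑ω : BondConfig V) B : ℝ) := by
    intro ω hω
    rw [hR]
    dsimp only
    rw [Real.log_mul (mul_pos (pow_pos ha _) (pow_pos hb _)).ne' (pow_pos hc _).ne',
      Real.log_mul (pow_pos ha _).ne' (pow_pos hb _).ne', Real.log_pow, Real.log_pow, Real.log_pow,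
      Finset.card_sdiff_of_subset hω, Nat.cast_sub (Finset.card_le_card hω)]
    ring
  have hE : rcExpect G p₁ q₁ B (fun ω => Real.log (R ω)) =
      Real.log (p₂ / p₁) * rcExpect G p₁ q₁ B (fun ω => (#ω : ℝ)) +
        Real.log ((1 - p₂) / (1 - p₁)) * ((#G.edgeFinset : ℝ) - rcExpect G p₁ q₁ B (fun ω => (#ω : ℝ))) +
        Real.log (q₂ / q₁) * rcExpect G p₁ q₁ B (fun ω => (clusterCount (↑ω : BondConfig V) B : ℝ)) := by
    rw [rcExpect_congr G p₁ q₁ B hlogR, rcExpect_add, rcExpect_add, rcExpect_const_mul, rcExpect_const_mul, rcExpect_const_mul,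
      rcExpect_sub, rcExpect_const G hp₁' hq₁]
  rw [← hE, ← Real.log_div hZ₂.ne' hZ₁.ne', hquot]
  exact hJ

end Jensen

section Convex₂

/-- **A function on `ℝ × ℝ` with a supporting plane at every point is convex.** [folklore] -/
theorem convexOn_of_forall_exists_support₂ {f : ℝ × ℝ → ℝ}
    (h : ∀ z : ℝ × ℝ, ∃ m : ℝ × ℝ, ∀ x : ℝ × ℝ, f z + m.1 * (x.1 - z.1) + m.2 * (x.2 - z.2) ≤ f x) :
    ConvexOn ℝ Set.univ f := by
  refine ⟨convex_univ, fun x _ y _ a b ha hb hab => ?_⟩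
  obtain ⟨m, hm⟩ := h (a • x + b • y)
  have hx := hm x
  have hy := hm y
  simp only [smul_eq_mul, Prod.smul_fst, Prod.smul_snd, Prod.fst_add, Prod.snd_add] at hx hy ⊢
  have h1 := mul_le_mul_of_nonneg_left hx ha
  have h2 := mul_le_mul_of_nonneg_left hy hb
  have e : a * (f (a • x + b • y) + m.1 * (x.1 - (a * x.1 + b * y.1)) + m.2 * (x.2 - (a * x.2 + b * y.2))) +
      b * (f (a • x + b • y) + m.1 * (y.1 - (a * x.1 + b * y.1)) + m.2 * (y.2 - (a * x.2 + b * y.2))) =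
      (a + b) * f (a • x + b • y) + m.1 * ((a * x.1 + b * y.1) * (1 - (a + b))) + m.2 * ((a * x.2 + b * y.2) * (1 - (a + b))) := by
    ring
  rw [hab] at e
  simp only [sub_self, mul_zero, add_zero, one_mul] at e
  linarith

/-- **A pointwise limit of functions convex on a convex subset of `ℝ × ℝ` is convex there** (the plane version of Literature
`Literature.Analysis.Convex.convexOn_univ_of_tendsto`). [folklore] -/
theorem convexOn_prod_of_tendsto {s : Set (ℝ × ℝ)} (hs : Convex ℝ s) {f : ℕ → ℝ × ℝ → ℝ} {g : ℝ × ℝ → ℝ}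
    (hf : ∀ N, ConvexOn ℝ s (f N)) (hlim : ∀ x ∈ s, Tendsto (fun N => f N x) atTop (𝓝 (g x))) : ConvexOn ℝ s g := by
  refine ⟨hs, fun x hx y hy a b ha hb hab => ?_⟩
  have h1 : Tendsto (fun N => f N (a • x + b • y)) atTop (𝓝 (g (a • x + b • y))) := hlim _ (hs hx hy ha hb hab)
  have h2 : Tendsto (fun N => a • f N x + b • f N y) atTop (𝓝 (a • g x + b • g y)) :=
    ((hlim x hx).const_smul a).add ((hlim y hy).const_smul b)
  exact le_of_tendsto_of_tendsto' h1 h2 fun N => (hf N).2 hx hy ha hb hab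

end Convex₂

section FiniteVolume₂

variable {V : Type*} [Fintype V] [DecidableEq V] (G : SimpleGraph V) [DecidableRel G.Adj]

/-- **The finite-volume pressure `log Y^B_G(π,κ)` is jointly convex in `(π, κ)`** (Grimmett 2006, proof of Thm. (4.58): "It is clear from its form
that `G^ξ_Λ(π,κ)` is a convex function on its domain ℝ²"; here from the supporting planes of `log_rcPartitionFunction_sub_ge₂` with gradient
`(E|ω|, E k^B)`): for every wired set `B`, `(π,κ) ↦ log Z^B_G(σ(π), e^κ) − |E(G)| log(1 − σ(π))` is convex on `ℝ × ℝ`.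
[cite: Grimmett2006, proof of Thm. (4.58) (convexity of G^ξ_Λ) with (4.54)–(4.56), (4.72)] -/
theorem convexOn_log_rcPartitionFunction_logistic_exp (B : Set V) :
    ConvexOn ℝ Set.univ (fun x : ℝ × ℝ =>
      Real.log (rcPartitionFunction G (Real.exp x.1 / (1 + Real.exp x.1)) (Real.exp x.2) B) -
        (#G.edgeFinset : ℝ) * Real.log (1 - Real.exp x.1 / (1 + Real.exp x.1))) := by
  refine convexOn_of_forall_exists_support₂ fun z => ?_
  refine ⟨(rcExpect G (Real.exp z.1 / (1 + Real.exp z.1)) (Real.exp z.2) B (fun ω => (#ω : ℝ)),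
    rcExpect G (Real.exp z.1 / (1 + Real.exp z.1)) (Real.exp z.2) B
      (fun ω => (clusterCount (↑ω : BondConfig V) B : ℝ))), fun x => ?_⟩
  -- the logistic chart
  have hσ : ∀ t : ℝ, Real.exp t / (1 + Real.exp t) ∈ Set.Ioo (0 : ℝ) 1 := fun t => by
    have h := Real.exp_pos t
    exact ⟨by positivity, by rw [div_lt_one (by positivity)]; linarith⟩
  have hlog : ∀ t : ℝ, Real.log (Real.exp t / (1 + Real.exp t)) - Real.log (1 - Real.exp t / (1 + Real.exp t)) = t := fun t => by
    have h1 : (0 : ℝ) < 1 + Real.exp t := by positivity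
    have e1 : 1 - Real.exp t / (1 + Real.exp t) = 1 / (1 + Real.exp t) := by field_simp; ring
    rw [e1, Real.log_div (Real.exp_pos t).ne' h1.ne', Real.log_div one_ne_zero h1.ne', Real.log_one, Real.log_exp]
    ring
  have hz := hσ z.1
  have hx := hσ x.1
  have key := log_rcPartitionFunction_sub_ge₂ G hz hx (Real.exp_pos z.2) (Real.exp_pos x.2) B
  rw [Real.log_div hx.1.ne' hz.1.ne', Real.log_div (sub_pos.2 hx.2).ne' (sub_pos.2 hz.2).ne',
    Real.log_div (Real.exp_pos x.2).ne' (Real.exp_pos z.2).ne', Real.log_exp, Real.log_exp] at key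
  have ex := hlog x.1
  have ez := hlog z.1
  set E₁ := rcExpect G (Real.exp z.1 / (1 + Real.exp z.1)) (Real.exp z.2) B (fun ω => (#ω : ℝ)) with hE₁
  set K₁ := rcExpect G (Real.exp z.1 / (1 + Real.exp z.1)) (Real.exp z.2) B
    (fun ω => (clusterCount (↑ω : BondConfig V) B : ℝ)) with hK₁
  -- the supporting plane: `log Y(x) − log Y(z) ≥ E₁ (x.1 − z.1) + K₁ (x.2 − z.2)`
  have h : E₁ * (x.1 - z.1) = (Real.log (Real.exp x.1 / (1 + Real.exp x.1)) - Real.log (Real.exp z.1 / (1 + Real.exp z.1))) * E₁ +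
      (Real.log (1 - Real.exp x.1 / (1 + Real.exp x.1)) - Real.log (1 - Real.exp z.1 / (1 + Real.exp z.1))) * ((#G.edgeFinset : ℝ) - E₁) -
        (#G.edgeFinset : ℝ) * (Real.log (1 - Real.exp x.1 / (1 + Real.exp x.1)) - Real.log (1 - Real.exp z.1 / (1 + Real.exp z.1))) := by
    have : x.1 - z.1 = (Real.log (Real.exp x.1 / (1 + Real.exp x.1)) - Real.log (1 - Real.exp x.1 / (1 + Real.exp x.1))) -
        (Real.log (Real.exp z.1 / (1 + Real.exp z.1)) - Real.log (1 - Real.exp z.1 / (1 + Real.exp z.1))) := by rw [ex, ez]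
    rw [this]
    ring
  simp only
  linarith

end FiniteVolume₂

section Pressure₂

variable {d : ℕ} {Ψ : ℝ → ℝ → ℝ}

/-- **Grimmett 2006, Thm. (4.58), convexity clause ("G is a convex function on its domain"), per site**: let `K ⊆ ℝ` be convex and suppose that
for every `π` and every `κ ∈ K` the per-site box pressures at `(p,q) = (σ(π), e^κ)` converge, `|Λ_N|⁻¹ log Z^b_{Λ_N}(σ(π), e^κ) → Ψ(σ(π), e^κ)`
(boundary condition `b`), and `|E_{Λ_N}|/|Λ_N| → d`. Then `(π, κ) ↦ Ψ(σ(π), e^κ) − d log(1 − σ(π))` — Grimmett's `d · G(π,κ)`, (4.70) — is convex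
on `ℝ × K` (for `K = [0,∞)`, i.e. `q ≥ 1`, the hypotheses are those delivered by `PressureThermodynamicLimit` / `LatticeEdgeCounting`).
[cite: Grimmett2006, Thm. (4.58) ("The 'pressure' function G is a convex function on its domain ℝ²")] -/
theorem convexOn_pressure_logistic_exp {K : Set ℝ} (hK : Convex ℝ K) {b : Bool}
    (hΨ : ∀ π : ℝ, ∀ κ ∈ K, Tendsto (fun N : ℕ =>
      Real.log (rcPartitionFunction (finsetGraph (zdGraph d) (box d N)) (Real.exp π / (1 + Real.exp π)) (Real.exp κ) (boxBC d b N)) /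
        #(box d N)) atTop (𝓝 (Ψ (Real.exp π / (1 + Real.exp π)) (Real.exp κ))))
    (hE : Tendsto (fun N : ℕ => (#(finsetGraph (zdGraph d) (box d N)).edgeFinset : ℝ) / #(box d N)) atTop (𝓝 (d : ℝ))) :
    ConvexOn ℝ (Set.univ ×ˢ K) (fun x : ℝ × ℝ =>
      Ψ (Real.exp x.1 / (1 + Real.exp x.1)) (Real.exp x.2) - d * Real.log (1 - Real.exp x.1 / (1 + Real.exp x.1))) := by
  have hs : Convex ℝ ((Set.univ : Set ℝ) ×ˢ K) := convex_univ.prod hK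
  refine convexOn_prod_of_tendsto hs (f := fun N x =>
      (Real.log (rcPartitionFunction (finsetGraph (zdGraph d) (box d N)) (Real.exp x.1 / (1 + Real.exp x.1)) (Real.exp x.2) (boxBC d b N)) -
        (#(finsetGraph (zdGraph d) (box d N)).edgeFinset : ℝ) * Real.log (1 - Real.exp x.1 / (1 + Real.exp x.1))) / #(box d N))
    (fun N => ?_) (fun x hx => ?_)
  · -- convexity on `ℝ × K` of the finite-volume function divided by `|Λ_N| > 0`
    have hpos : (0 : ℝ) < #(box d N) := by exact_mod_cast Finset.card_pos.2 (box_nonempty d N)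
    have h := ((convexOn_log_rcPartitionFunction_logistic_exp (finsetGraph (zdGraph d) (box d N)) (boxBC d b N)).subset
      (Set.subset_univ _) hs).smul (inv_nonneg.2 hpos.le)
    refine h.congr fun x _ => ?_
    simp only [smul_eq_mul]
    ring
  · have hκ : x.2 ∈ K := (Set.mem_prod.1 hx).2
    have h := ((hΨ x.1 x.2 hκ).sub (hE.mul_const (Real.log (1 - Real.exp x.1 / (1 + Real.exp x.1)))))
    refine h.congr fun N => ?_
    rw [sub_div, mul_div_right_comm]

end Pressure₂

end Summit.CriticalPhenomena.PercolationContinuityZ3.Theorems.FK
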